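import Summits.BirchSwinnertonDyer.Rank1Residual.GaloisImage.EPCCohomologyTransport
import Literature.NumberTheory.GaloisRepresentations.CyclicIndexEulerChar
import Literature.NumberTheory.GaloisRepresentations.CohomologicalDimensionProofs
import HarnessLib

/-!
# Descent of Tate's Euler–Poincaré count along a tower of index-`p` open subgroups
# (cell `b2b-bsdres`, team n1011, row T-EPC = Tate's local Euler–Poincaré characteristic; seat p04 GEN 8; stage D4)

HONEST FRAMING (cell `b2b-bsdres`, run/shared/lean/b2b/bsd-rank1-residual/, verbatim in every
file): the goal of the cell is to DELETE the COMBINATION-SHAPED residual classes of the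
Birch–Swinnerton-Dyer formula for ALL analytic-rank `≤ 1` elliptic curves over `ℚ` — "full BSD
formula for every rank `≤ 1` curve in class `C`" assembled STRICTLY from published theorems — so
that the rank-`≤ 1` remainder becomes exactly the CONSTRUCTION-SHAPED classes, which are TYPED
(missing-input `Prop`s), NOT attempted. This is not "finishing BSD". Team n1011 (N10 / N11, the
additive block X4 ∧ `p = 3`): research route; no claim beyond the stated classes; nothing is
booked; no mark / label is changed by this file. Theorems only (no definition, no named fact, no
`sorry`).  (Placement: Summits/GaloisImage with the T-EPC cone.)

## What

Serre's / Milne's reduction in the proof of Tate's theorem (Milne *ADT* I Thm. 2.8; Serre *CG*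
II §5.7, Lemme 7): for a profinite group `Γ` with `cd_p Γ ≤ 2`, a finite discrete `Γ`-module `M`
killed by `p`, and open subgroups `Δ' ≤ Δ ≤ Γ` with `Δ'` normal of index `p` in `Δ`, the tree's
cyclic step `card_euler_cyclic_step` (filtration of the induced module + Shapiro), applied in the
ambient group `Δ` and transported from `Δ'` viewed inside `Δ` to `Δ'` itself, gives

* `EPCDescent.finite_and_card_step` — `H¹(Δ', M)`, `H²(Δ', M)` finite and
  `#M^{Δ'} · #H²(Δ') · #H¹(Δ)^p = #H¹(Δ') · (#M^Δ · #H²(Δ))^p`;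
* `EPCDescent.epc_step` — if `#M^{Δ'} · #H²(Δ') · x^p = #H¹(Δ')` then `#M^Δ · #H²(Δ) · x = #H¹(Δ)`;
* `EPCDescent.epc_tower` — the same along a chain `Δ₀ ⊵ Δ₁ ⊵ ⋯ ⊵ Δ_a` of index-`p` steps:
  the truncated Euler–Poincaré identity with factor `x^(p^a)` at `Δ_a` gives the one with factor
  `x` at `Δ₀`;
* `EPCDescent.natCard_restrict_top`, `…_invariants_restrict_top`, `finite_restrict_top_iff` —
  `Γ` versus its subgroup `⊤`.

References: J.-P. Serre, *Galois Cohomology* (1997), II §5.7 [SerreGaloisCohomology1997];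
J. S. Milne, *Arithmetic Duality Theorems* (2006), I §2 Thm. 2.8 [MilneADT2006].
-/

noncomputable section

open CategoryTheory Function
open Literature.NumberTheory.GaloisRepresentations

universe u

namespace Summit.BirchSwinnertonDyer.Rank1Residual.GaloisImage

namespace EPCDescent

variable {Γ : Type u} [Group Γ] [TopologicalSpace Γ] [IsTopologicalGroup Γ] [CompactSpace Γ]
  [T2Space Γ] [TotallyDisconnectedSpace Γ]
variable {M : Type u} [AddCommGroup M] [TopologicalSpace M] [DiscreteTopology M] [Finite M]
variable (ρ : ContinuousRep Γ ℤ M) {p : ℕ}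

omit [IsTopologicalGroup Γ] [CompactSpace Γ] [T2Space Γ] [TotallyDisconnectedSpace Γ] [DiscreteTopology M]
  [Finite M] in
/-- Restricting to `Δ` and then to `Δ' ≤ Δ` (as `Δ'.subgroupOf Δ`) is restricting to `Δ'`, along
the isomorphism `Δ'.subgroupOf Δ ≃ₜ* Δ'`. [folklore] -/
theorem exists_equiv_restrict_subgroupOf {Δ Δ' : Subgroup Γ} (hle : Δ' ≤ Δ) :
    ∃ e : Δ'.subgroupOf Δ ≃ₜ* Δ', ∀ x m,
      ((ρ.restrict (subgroupIncl Δ)).restrict (subgroupIncl (Δ'.subgroupOf Δ))) x m =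
        (ρ.restrict (subgroupIncl Δ')) (e x) m := by
  obtain ⟨e, he⟩ := EPCTransport.exists_continuousMulEquiv_subgroupOf (G := Γ) hle
  refine ⟨e, fun x m => ?_⟩
  simp only [ContinuousRep.restrict_apply, subgroupIncl_apply]
  rw [he x]

/-- **One cyclic step of index `p`, between open subgroups.** For `Δ' ≤ Δ` open in a profinite
`Γ` with `cd_p Γ ≤ 2`, `Δ'` normal of index `p` in `Δ`, `M` finite killed by `p` with
`H¹(Δ, M)`, `H²(Δ, M)` finite: `H¹(Δ', M)`, `H²(Δ', M)` are finite and
`#M^{Δ'} · #H²(Δ', M) · #H¹(Δ, M)^p = #H¹(Δ', M) · (#M^Δ · #H²(Δ, M))^p`.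
[cite: SerreGaloisCohomology1997, II §5.7 Lemme 7] [cite: MilneADT2006, I §2 Thm. 2.8 (proof)] -/
theorem finite_and_card_step (hp : p.Prime) (hcd : GroupCdLE Γ p 2) (hpM : ∀ m : M, p • m = 0)
    {Δ Δ' : Subgroup Γ} (hle : Δ' ≤ Δ) [hN : (Δ'.subgroupOf Δ).Normal] (hidx : Δ'.relIndex Δ = p)
    (hΔ : IsOpen (Δ : Set Γ)) (hΔ' : IsOpen (Δ' : Set Γ))
    [Finite (continuousCohomology 1 (ρ.restrict (subgroupIncl Δ)).toTopRep)]
    [Finite (continuousCohomology 2 (ρ.restrict (subgroupIncl Δ)).toTopRep)] :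
    Finite (continuousCohomology 1 (ρ.restrict (subgroupIncl Δ')).toTopRep) ∧
    Finite (continuousCohomology 2 (ρ.restrict (subgroupIncl Δ')).toTopRep) ∧
    Nat.card (ρ.restrict (subgroupIncl Δ')).toTopRep.ρ.invariants *
        Nat.card (continuousCohomology 2 (ρ.restrict (subgroupIncl Δ')).toTopRep) *
        Nat.card (continuousCohomology 1 (ρ.restrict (subgroupIncl Δ)).toTopRep) ^ p =
      Nat.card (continuousCohomology 1 (ρ.restrict (subgroupIncl Δ')).toTopRep) *
        (Nat.card (ρ.restrict (subgroupIncl Δ)).toTopRep.ρ.invariants *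
          Nat.card (continuousCohomology 2 (ρ.restrict (subgroupIncl Δ)).toTopRep)) ^ p := by
  haveI : Fact p.Prime := ⟨hp⟩
  have hΔcl : IsClosed (Δ : Set Γ) := Subgroup.isClosed_of_isOpen Δ hΔ
  haveI : CompactSpace Δ := isCompact_iff_compactSpace.mp hΔcl.isCompact
  -- the data of the tree's cyclic step, in the ambient group `Δ`
  set S : Subgroup Δ := Δ'.subgroupOf Δ with hSdef
  have hSidx : S.index = p := hidx
  have hSo : IsOpen (S : Set Δ) := hΔ'.preimage continuous_subtype_val
  obtain ⟨γ, hγ⟩ : ∃ γ : Δ, γ ∉ S := by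
    by_contra h
    have : S = ⊤ := top_le_iff.mp fun x _ => not_not.mp (not_exists.mp h x)
    rw [this, Subgroup.index_top] at hSidx
    exact hp.one_lt.ne hSidx
  have h3 : ∀ {V : Type u} [AddCommGroup V] [TopologicalSpace V] [DiscreteTopology V]
      (τ : ContinuousRep Δ ℤ V), (∀ v : V, p • v = 0) → Subsingleton (continuousCohomology 3 τ.toTopRep) :=
    fun τ hV => groupCdLE_subgroup_of_isClosed_holds Γ Δ hΔcl p 2 hcd _ τ
      (fun v => ⟨1, by rw [pow_one]; exact hV v⟩) (by norm_num)
  have hfin1 := finite_continuousCohomology_restrict_one (S := S) (ρ := ρ.restrict (subgroupIncl Δ))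
    hp hSidx hγ hSo hpM h3
  have hfin2 := finite_continuousCohomology_restrict_two (S := S) (ρ := ρ.restrict (subgroupIncl Δ))
    hp hSidx hγ hSo hpM h3
  have hcount := card_euler_cyclic_step (S := S) (ρ := ρ.restrict (subgroupIncl Δ)) hp hSidx hγ hSo hpM h3
  -- transport from `S = Δ'.subgroupOf Δ` to `Δ'`
  obtain ⟨e, he⟩ := exists_equiv_restrict_subgroupOf ρ hle
  rw [EPCTransport.natCard_continuousCohomology_congr e _ _ he 2,
    EPCTransport.natCard_continuousCohomology_congr e _ _ he 1,
    EPCTransport.natCard_invariants_congr e _ _ he] at hcount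
  exact ⟨(EPCTransport.finite_continuousCohomology_iff e _ _ he 1).1 hfin1,
    (EPCTransport.finite_continuousCohomology_iff e _ _ he 2).1 hfin2, hcount⟩

omit [IsTopologicalGroup Γ] [CompactSpace Γ] [T2Space Γ] [TotallyDisconnectedSpace Γ] in
/-- `#M^Δ ≠ 0` for an open... indeed any subgroup: the invariants of a finite module form a
finite nonempty set. [folklore] -/
theorem natCard_invariants_ne_zero (Δ : Subgroup Γ) :
    Nat.card (ρ.restrict (subgroupIncl Δ)).toTopRep.ρ.invariants ≠ 0 := by
  haveI : Finite (ρ.restrict (subgroupIncl Δ)).toTopRep.ρ.invariants :=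
    Finite.of_injective (fun m => (m : M)) Subtype.val_injective
  exact Nat.card_pos.ne'

/-- **The Euler–Poincaré identity descends one index-`p` step**: under the hypotheses of
`finite_and_card_step`, if `#M^{Δ'} · #H²(Δ', M) · x^p = #H¹(Δ', M)` then
`#M^Δ · #H²(Δ, M) · x = #H¹(Δ, M)`. [cite: SerreGaloisCohomology1997, II §5.7 Lemme 7]
[cite: MilneADT2006, I §2 Thm. 2.8 (proof)] -/
theorem epc_step (hp : p.Prime) (hcd : GroupCdLE Γ p 2) (hpM : ∀ m : M, p • m = 0)
    {Δ Δ' : Subgroup Γ} (hle : Δ' ≤ Δ) [hN : (Δ'.subgroupOf Δ).Normal] (hidx : Δ'.relIndex Δ = p)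
    (hΔ : IsOpen (Δ : Set Γ)) (hΔ' : IsOpen (Δ' : Set Γ))
    [Finite (continuousCohomology 1 (ρ.restrict (subgroupIncl Δ)).toTopRep)]
    [Finite (continuousCohomology 2 (ρ.restrict (subgroupIncl Δ)).toTopRep)] (x : ℕ)
    (hΔ'epc : Nat.card (ρ.restrict (subgroupIncl Δ')).toTopRep.ρ.invariants *
        Nat.card (continuousCohomology 2 (ρ.restrict (subgroupIncl Δ')).toTopRep) * x ^ p =
      Nat.card (continuousCohomology 1 (ρ.restrict (subgroupIncl Δ')).toTopRep)) :
    Nat.card (ρ.restrict (subgroupIncl Δ)).toTopRep.ρ.invariants *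
        Nat.card (continuousCohomology 2 (ρ.restrict (subgroupIncl Δ)).toTopRep) * x =
      Nat.card (continuousCohomology 1 (ρ.restrict (subgroupIncl Δ)).toTopRep) := by
  obtain ⟨-, hfin2, hcount⟩ := finite_and_card_step ρ hp hcd hpM hle hidx hΔ hΔ'
  rw [← hΔ'epc] at hcount
  have hne : Nat.card (ρ.restrict (subgroupIncl Δ')).toTopRep.ρ.invariants *
      Nat.card (continuousCohomology 2 (ρ.restrict (subgroupIncl Δ')).toTopRep) ≠ 0 :=
    mul_ne_zero (natCard_invariants_ne_zero ρ Δ') Nat.card_pos.ne'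
  have h1 : Nat.card (continuousCohomology 1 (ρ.restrict (subgroupIncl Δ)).toTopRep) ^ p =
      (Nat.card (ρ.restrict (subgroupIncl Δ)).toTopRep.ρ.invariants *
        Nat.card (continuousCohomology 2 (ρ.restrict (subgroupIncl Δ)).toTopRep) * x) ^ p := by
    apply mul_left_cancel₀ hne
    rw [hcount]
    ring
  exact (Nat.pow_left_injective hp.ne_zero h1).symm

/-- **Descent along a tower of index-`p` steps.** Let `Δ 0 ⊵ Δ 1 ⊵ ⋯ ⊵ Δ a` be open subgroups of a
profinite `Γ` with `cd_p Γ ≤ 2`, each `Δ (i+1)` normal of index `p` in `Δ i`, and `M` finite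
killed by `p` with `H¹(Δ 0, M)`, `H²(Δ 0, M)` finite.  Then `H¹(Δ a, M)`, `H²(Δ a, M)` are finite,
and `#M^{Δ a} · #H²(Δ a) · x^(p^a) = #H¹(Δ a)` implies `#M^{Δ 0} · #H²(Δ 0) · x = #H¹(Δ 0)`.
[cite: SerreGaloisCohomology1997, II §5.7 Lemme 7] [cite: MilneADT2006, I §2 Thm. 2.8 (proof)] -/
theorem epc_tower (hp : p.Prime) (hcd : GroupCdLE Γ p 2) (hpM : ∀ m : M, p • m = 0)
    (Δ : ℕ → Subgroup Γ) (a : ℕ) (hle : ∀ i < a, Δ (i + 1) ≤ Δ i)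
    (hN : ∀ i < a, ((Δ (i + 1)).subgroupOf (Δ i)).Normal)
    (hidx : ∀ i < a, (Δ (i + 1)).relIndex (Δ i) = p) (hopen : ∀ i ≤ a, IsOpen (Δ i : Set Γ))
    [Finite (continuousCohomology 1 (ρ.restrict (subgroupIncl (Δ 0))).toTopRep)]
    [Finite (continuousCohomology 2 (ρ.restrict (subgroupIncl (Δ 0))).toTopRep)] (x : ℕ) :
    Finite (continuousCohomology 1 (ρ.restrict (subgroupIncl (Δ a))).toTopRep) ∧
    Finite (continuousCohomology 2 (ρ.restrict (subgroupIncl (Δ a))).toTopRep) ∧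
    (Nat.card (ρ.restrict (subgroupIncl (Δ a))).toTopRep.ρ.invariants *
        Nat.card (continuousCohomology 2 (ρ.restrict (subgroupIncl (Δ a))).toTopRep) * x ^ (p ^ a) =
      Nat.card (continuousCohomology 1 (ρ.restrict (subgroupIncl (Δ a))).toTopRep) →
     Nat.card (ρ.restrict (subgroupIncl (Δ 0))).toTopRep.ρ.invariants *
        Nat.card (continuousCohomology 2 (ρ.restrict (subgroupIncl (Δ 0))).toTopRep) * x =
      Nat.card (continuousCohomology 1 (ρ.restrict (subgroupIncl (Δ 0))).toTopRep)) := by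
  -- induction on the level `n ≤ a`, for all `x`
  suffices key : ∀ n ≤ a, ∀ y : ℕ,
      Finite (continuousCohomology 1 (ρ.restrict (subgroupIncl (Δ n))).toTopRep) ∧
      Finite (continuousCohomology 2 (ρ.restrict (subgroupIncl (Δ n))).toTopRep) ∧
      (Nat.card (ρ.restrict (subgroupIncl (Δ n))).toTopRep.ρ.invariants *
          Nat.card (continuousCohomology 2 (ρ.restrict (subgroupIncl (Δ n))).toTopRep) * y ^ (p ^ n) =
        Nat.card (continuousCohomology 1 (ρ.restrict (subgroupIncl (Δ n))).toTopRep) →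
       Nat.card (ρ.restrict (subgroupIncl (Δ 0))).toTopRep.ρ.invariants *
          Nat.card (continuousCohomology 2 (ρ.restrict (subgroupIncl (Δ 0))).toTopRep) * y =
        Nat.card (continuousCohomology 1 (ρ.restrict (subgroupIncl (Δ 0))).toTopRep)) from
    key a le_rfl x
  intro n
  induction n with
  | zero =>
    intro _ y
    refine ⟨inferInstance, inferInstance, fun h => ?_⟩
    rwa [pow_zero, pow_one] at h
  | succ n ih =>
    intro hn y
    obtain ⟨hf1, hf2, himp⟩ := ih (Nat.le_of_succ_le hn) y
    have hn' : n < a := hn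
    haveI := hN n hn'
    obtain ⟨hf1', hf2', -⟩ := finite_and_card_step ρ hp hcd hpM (hle n hn') (hidx n hn')
      (hopen n hn'.le) (hopen (n + 1) hn)
    refine ⟨hf1', hf2', fun h => himp ?_⟩
    refine epc_step ρ hp hcd hpM (hle n hn') (hidx n hn') (hopen n hn'.le) (hopen (n + 1) hn)
      (y ^ p ^ n) ?_
    rw [← pow_mul, ← pow_succ]
    exact h

/-! ### `Γ` versus its subgroup `⊤` -/

omit [IsTopologicalGroup Γ] [CompactSpace Γ] [T2Space Γ] [TotallyDisconnectedSpace Γ] [DiscreteTopology M]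
  [Finite M] in
/-- The restriction to `⊤ ≤ Γ` is `ρ` along `⊤ ≃ₜ* Γ`. [folklore] -/
theorem exists_equiv_restrict_top :
    ∃ e : (⊤ : Subgroup Γ) ≃ₜ* Γ, ∀ x m, (ρ.restrict (subgroupIncl ⊤)) x m = ρ (e x) m := by
  refine ⟨{ Subgroup.topEquiv with
    continuous_toFun := continuous_subtype_val
    continuous_invFun := Continuous.subtype_mk continuous_id _ }, fun x m => rfl⟩

omit [CompactSpace Γ] [T2Space Γ] [TotallyDisconnectedSpace Γ] [Finite M] in
/-- `#H^q(⊤, M) = #H^q(Γ, M)`. [folklore] -/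
theorem natCard_restrict_top (q : ℕ) :
    Nat.card (continuousCohomology q (ρ.restrict (subgroupIncl ⊤)).toTopRep) =
      Nat.card (continuousCohomology q ρ.toTopRep) := by
  obtain ⟨e, he⟩ := exists_equiv_restrict_top ρ
  exact EPCTransport.natCard_continuousCohomology_congr e _ _ he q

omit [CompactSpace Γ] [T2Space Γ] [TotallyDisconnectedSpace Γ] [Finite M] in
/-- `H^q(⊤, M)` is finite iff `H^q(Γ, M)` is. [folklore] -/
theorem finite_restrict_top_iff (q : ℕ) :
    Finite (continuousCohomology q (ρ.restrict (subgroupIncl ⊤)).toTopRep) ↔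
      Finite (continuousCohomology q ρ.toTopRep) := by
  obtain ⟨e, he⟩ := exists_equiv_restrict_top ρ
  exact EPCTransport.finite_continuousCohomology_iff e _ _ he q

omit [IsTopologicalGroup Γ] [CompactSpace Γ] [T2Space Γ] [TotallyDisconnectedSpace Γ] [Finite M] in
/-- `#M^⊤ = #M^Γ`. [folklore] -/
theorem natCard_invariants_restrict_top :
    Nat.card (ρ.restrict (subgroupIncl ⊤)).toTopRep.ρ.invariants = Nat.card ρ.toTopRep.ρ.invariants := by
  obtain ⟨e, he⟩ := exists_equiv_restrict_top ρ
  exact EPCTransport.natCard_invariants_congr e _ _ he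

end EPCDescent

end Summit.BirchSwinnertonDyer.Rank1Residual.GaloisImage

end
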